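import Summits.QuantumFields.YangMills.Theorems.BalabanUVNodesN15FullPropagatorV1XNonVanishing
import Summits.QuantumFields.YangMills.Theorems.BalabanUVNodesN15FullPropagatorC2BgExactUnitN15At
import HarnessLib

/-!
# Route «BalabanUVNodes», cluster K4 «SpineRates» — node N15 = NE2: R3-ter — THE KERNEL NON-VANISHING LETTER FOR THE PRIMITIVE-CARRIER (BY-PARTS DRESSED) FAMILIES:
# dag-n15-c's `fgFamilyC2` AT THE TRIVIAL COEFFICIENTS is Bałaban's genuine two-grid defect, hence dag-n15-a's `c2Objects` ∕ `c2BgObjects` ∕ `c2BgExObjects` (the families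
# behind (M), U-D∕U-E, V-D∕V-E and the N27 twins) are NOT the zero kernels; a reading equation `ne2 = c2…Objects …` FAILS for every zero-kernel reading

Cell `pub-ymgap`, WIDTH SEAT `pub-ymgap-dag-n15-w1` (HUMAN RULING D-0149), generation 0, file R3-ter.  Filed `--kind proof --supports stmt-QuantumFields-20544 --as helper` —
COUNT-NEUTRAL; theorems only (0 `def`, 0 `sorry`); imports this seat's R3-bis `…N15FullPropagatorV1XNonVanishing` (`bgPropV_zero_right`, the generic `ne_of_kop_zero_of_exists_ne`, R3
§2 through it) and dag-n15-a's V-D `…N15FullPropagatorC2BgExactUnitN15At` (`c2BgExObjects`; through it U-D `c2BgObjects`, part 81 `c2Objects`, dag-n15-c FILE 11 `fgFamilyC2` ∕ FILE 7a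
`bgOpsBP`); nothing in the tree is modified or re-declared.

WHY.  R3 (p593525) ∕ R3-bis exclude the zero-kernel readings from the v2 pin target `fullGSizedObjects` and from the v3 candidate `v1XASObjects`.  The THIRD family of N15 objects with
faces at the reading of record — the primitive-carrier by-parts family with the background-LIVE unit layer (`c2BgObjects` U-D∕U-E p58xxxx, `c2BgExObjects` V-D∕V-E, the N27 R-β twins
p589713 ∕ p594748) — enters K3⁷ through a READING EQUATION `hne2 : ne2 F θ g₀ os k = c2Bg(Ex)Objects 3 F.hL b a_S α α' c₃₅ p`; the same zero-kernel objection applies to it unless its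
operator kernels are known not to vanish.  THIS FILE: at the primitive carrier's trivial configuration `(c′, a′) = 0` (`Bf.one`) the block means vanish (`avg₁_zero`), the unstacked
perturbation is `0`, the Neumann-dressed pair is the stacked `U ≡ 1` pair (`bgPropV_zero_right`), so entry 0 of FILE 7a's `bgOpsBP` IS `𝔇(G′, G) = G′P − PG` — non-zero at every index
with `m ≥ 1` by R3 §2.  Exact algebra; no estimate.

WHAT.  §1 `unstack_zero_eq` (generic; dag-n15-a U-D has the torus instance `UnitLayerBg.unstack_zero`), `bgPair_zero`, `bgOpsBP_zero_apply_zero`; §2 ★★ `exists_fgFamilyC2_e_ne_zero` (every index with `m ≥ 1`, at `Bf.one`), ★★ `exists_c2Objects_kop_e_ne_zero` ∕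
`exists_c2BgObjects_kop_e_ne_zero` ∕ `exists_c2BgExObjects_kop_e_ne_zero`, `ne_c2Objects_of_kop_zero` ∕ `ne_c2BgObjects_of_kop_zero` ∕ `ne_c2BgExObjects_of_kop_zero` (object level, `d ≥ 1`);
§3 (`d + 1 = 4`) the `_family` forms on a datum family's block factor.

HONEST FRAMING.  Helper lane, count-neutral.  Exact algebra about MODEL-LEVEL (species ∕ primitive-carrier) objects at the trivial background; no estimate, no datum content;
nothing of Bałaban's analysis asserted; NE2⁺ NOT PRINTED ∕ NOT PROVED; N15 NOT discharged (typed 28∕28 · discharged 5∕27, A 5∕28 UNMOVED); K3⁷ OPEN, not claimed; no pin is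
proposed here (the plan pins).  The Yang–Mills mass gap (Clay) is NOT proved by any of this — R4 closes the conditional finite-𝕋⁴ rung `BalabanLadder.UV` only; nothing continuum ∕
ℝ⁴ ∕ OS ∕ infinite volume.  Restate-immune (no Theses import).
-/

set_option autoImplicit false

namespace Summit.QuantumFields.YangMills.BalabanUVNodes.N15.SizedNonVanishing

open Finset
open Literature.MathematicalPhysics.QuantumFieldTheory.Balaban1983to89
open Literature.MathematicalPhysics.QuantumFieldTheory.Balaban1983to89.B5Prop11Plancherel (Tor fine)
open Literature.MathematicalPhysics.QuantumFieldTheory.Balaban1983to89.T4EtaRateDefect (idef idef_apply)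
open Literature.MathematicalPhysics.QuantumFieldTheory.Balaban1983to89.T4EtaRateCoeffDefect (pull pull_apply)
open Literature.MathematicalPhysics.QuantumFieldTheory.Balaban1983to89.B11SectG (BlockNorm)
open Literature.MathematicalPhysics.QuantumFieldTheory.Balaban1983to89.B11AxialTransport190 (abs_le_loc_ofBlocks)
open Literature.MathematicalPhysics.QuantumFieldTheory.Balaban1983to89.B6UnitTorusCarrier (unitTorusGeo)
open Literature.MathematicalPhysics.QuantumFieldTheory.Balaban1983to89.T4Continuum (T4Family ULoop)
open Summit.QuantumFields.YangMills.BalabanUVNodes.N15.TwoGrid (gOp TGIndex)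
open Summit.QuantumFields.YangMills.BalabanUVNodes.N15.VectorPiece (kingPrV blkFine)
open Summit.QuantumFields.YangMills.BalabanUVNodes.N15.BackgroundLayer (projO stack projO_none_comp_stack bgPropV unstack unstack_apply bgPair bgOpsBP avg₁ avg₁_zero
  fgInstanceC2 fgFamilyC2)
open Summit.QuantumFields.YangMills.BalabanUVNodes.N15.GenuineRecord (FGIndexL c2Objects)
open Summit.QuantumFields.YangMills.BalabanUVNodes.N15.UnitLayerBg (c2BgObjects c2BgExObjects)
open Summit.QuantumFields.YangMills.BalabanUVNodes.N15.AtKeyedHome (neZero_blockFactor)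
open Node00 (NE2Objects₁₁)

variable {d : ℕ}

/-! ## §1 At the trivial coefficients the by-parts dressed pair is the `U ≡ 1` pair -/

section ZeroPair

variable {X X' J : Type} [Fintype J]

/-- The unstacked first-order perturbation with ZERO scalar coefficients is the zero map. [folklore] -/
theorem unstack_zero_eq [Fintype X] : unstack (0 : X → ℝ) (0 : J → X → ℝ) = 0 :=
  LinearMap.ext fun f => funext fun x => by simp [unstack_apply]

/-- At zero coefficients n15-b's dressed pair IS the stacked `U ≡ 1` pair. [cite: Balaban1985BackgroundPropagators, (3.64)–(3.65) p.403 (shape)] -/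
theorem bgPair_zero [Fintype X] [DecidableEq X] [DecidableEq J] (G : (X → ℝ) →ₗ[ℝ] (X → ℝ)) (D : J → (X → ℝ) →ₗ[ℝ] (X → ℝ)) :
    bgPair G D (0 : X → ℝ) (0 : J → X → ℝ) = stack G D := by
  unfold bgPair
  rw [unstack_zero_eq, bgPropV_zero_right]

/-- **ENTRY 0 OF FILE 7a's BY-PARTS OPERATOR TUPLE AT THE ZERO COEFFICIENTS IS THE `U ≡ 1` DEFECT `𝔇(G′, G)`** (block means of zero are zero: `avg₁_zero`).
[cite: Balaban1985BackgroundPropagators, (3.42) p.397, (3.65) p.403 (shapes)] -/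
theorem bgOpsBP_zero_apply_zero [Fintype X] [Fintype X'] [DecidableEq X] [DecidableEq X'] [DecidableEq J] (π : X' → X) (τ : J → X ≃ X) (τ' : J → X' ≃ X') (n n' : ℝ) (ν : J)
    (G D₃ : (X → ℝ) →ₗ[ℝ] (X → ℝ)) (D : J → (X → ℝ) →ₗ[ℝ] (X → ℝ)) (G' D₃' : (X' → ℝ) →ₗ[ℝ] (X' → ℝ)) (D' : J → (X' → ℝ) →ₗ[ℝ] (X' → ℝ)) :
    bgOpsBP π τ τ' n n' ν G D₃ D G' D₃' D' 0 0 = idef (pull π) (pull π) G' G := by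
  show idef (pull π) (pull π) (projO none ∘ₗ bgPair G' D' (0 : (X' → ℝ) × (J → X' → ℝ)).1 (0 : (X' → ℝ) × (J → X' → ℝ)).2)
    (projO none ∘ₗ bgPair G D (avg₁ J π 0).1 (avg₁ J π 0).2) = _
  rw [avg₁_zero, Prod.fst_zero, Prod.snd_zero, Prod.fst_zero, Prod.snd_zero, bgPair_zero, bgPair_zero, projO_none_comp_stack, projO_none_comp_stack]

end ZeroPair

/-! ## §2 The primitive-carrier family and the three `NE2Objects₁₁` literals built on it: not the zero kernels -/

section Primitive

variable {L : ℕ} [NeZero L]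

/-- ★★ **ENTRY 0 OF dag-n15-c's PRIMITIVE-CARRIER BY-PARTS FAMILY AT THE TRIVIAL COEFFICIENTS `(c′, a′) = 0` IS NOT THE ZERO KERNEL** at every index with `m ≥ 1` (`b > 0`, odd
`L > 1`, `d ≥ 1`): there entry 0 is `𝔇(G′, G) = G′P − PG` (§1), non-zero by R3 §2. [cite: Balaban1985BackgroundPropagators, (3.42) p.397 (the entry: shape); Balaban1984PropagatorsI, (1.69) p.29] -/
theorem exists_fgFamilyC2_e_ne_zero (hd : 1 ≤ d) (hL : Odd L ∧ 1 < L) {b : ℝ} (hb : 0 < b) (i : TGIndex × Fin (d + 1)) (hi : 1 ≤ i.1.m) :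
    ∃ lam y, (fgFamilyC2 d hL b i).e 0 (fgInstanceC2 d hL i).Bf.one lam y ≠ 0 := by
  have h3 : 3 ≤ L := by obtain ⟨r, hr⟩ := hL.1; omega
  obtain ⟨lam, x', hne⟩ := exists_twoGridDefect_apply_ne_zero (TGIndex.Mn d hL i.1) hd h3 i.1.k i.1.m i.1.one_le hi hb
  refine ⟨lam, blkFine L i.1.k (TGIndex.Mn d hL i.1) (kingPrV L i.1.k i.1.m (TGIndex.Mn d hL i.1) x'), fun hz => hne ?_⟩
  have hle : |(bgOpsBP (kingPrV L i.1.k i.1.m (TGIndex.Mn d hL i.1)) (fun μ => VectorPiece.bshiftEquiv (TGIndex.Mn d hL i.1) (L ^ i.1.k) μ)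
      (fun μ => VectorPiece.bshiftEquiv (TGIndex.Mn d hL i.1) (L ^ i.1.m * L ^ i.1.k) μ) ((L ^ i.1.k : ℕ) : ℝ) ((L ^ i.1.m * L ^ i.1.k : ℕ) : ℝ) i.2
      (gOp (TGIndex.Mn d hL i.1) (L ^ i.1.k) b)
      (TwoGrid.symbOp (TGIndex.Mn d hL i.1) (L ^ i.1.k) (TwoGrid.sLap (TGIndex.Mn d hL i.1) (L ^ i.1.k) ((L ^ i.1.k : ℕ) : ℝ)) ∘ₗ gOp (TGIndex.Mn d hL i.1) (L ^ i.1.k) b)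
      (BackgroundLayer.fgD d (TGIndex.Mn d hL i.1) (L ^ i.1.k) b)
      (gOp (TGIndex.Mn d hL i.1) (L ^ i.1.m * L ^ i.1.k) b)
      (TwoGrid.symbOp (TGIndex.Mn d hL i.1) (L ^ i.1.m * L ^ i.1.k) (TwoGrid.sLap (TGIndex.Mn d hL i.1) (L ^ i.1.m * L ^ i.1.k) ((L ^ i.1.m * L ^ i.1.k : ℕ) : ℝ)) ∘ₗ
        gOp (TGIndex.Mn d hL i.1) (L ^ i.1.m * L ^ i.1.k) b)
      (BackgroundLayer.fgD d (TGIndex.Mn d hL i.1) (L ^ i.1.m * L ^ i.1.k) b) 0 (fgInstanceC2 d hL i).Bf.one lam) x'| ≤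
      (fgFamilyC2 d hL b i).e 0 (fgInstanceC2 d hL i).Bf.one lam (blkFine L i.1.k (TGIndex.Mn d hL i.1) (kingPrV L i.1.k i.1.m (TGIndex.Mn d hL i.1) x')) :=
    abs_le_loc_ofBlocks (g := unitTorusGeo L i.1.k (TGIndex.Mn d hL i.1)) (blkFine L i.1.k (TGIndex.Mn d hL i.1) ∘ kingPrV L i.1.k i.1.m (TGIndex.Mn d hL i.1)) _ rfl
  rw [hz] at hle
  have h00 := abs_eq_zero.mp (le_antisymm hle (abs_nonneg _))
  have h0 := bgOpsBP_zero_apply_zero (kingPrV L i.1.k i.1.m (TGIndex.Mn d hL i.1)) (fun μ => VectorPiece.bshiftEquiv (TGIndex.Mn d hL i.1) (L ^ i.1.k) μ)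
      (fun μ => VectorPiece.bshiftEquiv (TGIndex.Mn d hL i.1) (L ^ i.1.m * L ^ i.1.k) μ) ((L ^ i.1.k : ℕ) : ℝ) ((L ^ i.1.m * L ^ i.1.k : ℕ) : ℝ) i.2
      (gOp (TGIndex.Mn d hL i.1) (L ^ i.1.k) b)
      (TwoGrid.symbOp (TGIndex.Mn d hL i.1) (L ^ i.1.k) (TwoGrid.sLap (TGIndex.Mn d hL i.1) (L ^ i.1.k) ((L ^ i.1.k : ℕ) : ℝ)) ∘ₗ gOp (TGIndex.Mn d hL i.1) (L ^ i.1.k) b)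
      (BackgroundLayer.fgD d (TGIndex.Mn d hL i.1) (L ^ i.1.k) b)
      (gOp (TGIndex.Mn d hL i.1) (L ^ i.1.m * L ^ i.1.k) b)
      (TwoGrid.symbOp (TGIndex.Mn d hL i.1) (L ^ i.1.m * L ^ i.1.k) (TwoGrid.sLap (TGIndex.Mn d hL i.1) (L ^ i.1.m * L ^ i.1.k) ((L ^ i.1.m * L ^ i.1.k : ℕ) : ℝ)) ∘ₗ
        gOp (TGIndex.Mn d hL i.1) (L ^ i.1.m * L ^ i.1.k) b)
      (BackgroundLayer.fgD d (TGIndex.Mn d hL i.1) (L ^ i.1.m * L ^ i.1.k) b)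
  have h01 : idef (pull (kingPrV L i.1.k i.1.m (TGIndex.Mn d hL i.1))) (pull (kingPrV L i.1.k i.1.m (TGIndex.Mn d hL i.1)))
      (gOp (TGIndex.Mn d hL i.1) (L ^ i.1.m * L ^ i.1.k) b) (gOp (TGIndex.Mn d hL i.1) (L ^ i.1.k) b) lam x' =
      (bgOpsBP (kingPrV L i.1.k i.1.m (TGIndex.Mn d hL i.1)) (fun μ => VectorPiece.bshiftEquiv (TGIndex.Mn d hL i.1) (L ^ i.1.k) μ)
      (fun μ => VectorPiece.bshiftEquiv (TGIndex.Mn d hL i.1) (L ^ i.1.m * L ^ i.1.k) μ) ((L ^ i.1.k : ℕ) : ℝ) ((L ^ i.1.m * L ^ i.1.k : ℕ) : ℝ) i.2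
      (gOp (TGIndex.Mn d hL i.1) (L ^ i.1.k) b)
      (TwoGrid.symbOp (TGIndex.Mn d hL i.1) (L ^ i.1.k) (TwoGrid.sLap (TGIndex.Mn d hL i.1) (L ^ i.1.k) ((L ^ i.1.k : ℕ) : ℝ)) ∘ₗ gOp (TGIndex.Mn d hL i.1) (L ^ i.1.k) b)
      (BackgroundLayer.fgD d (TGIndex.Mn d hL i.1) (L ^ i.1.k) b)
      (gOp (TGIndex.Mn d hL i.1) (L ^ i.1.m * L ^ i.1.k) b)
      (TwoGrid.symbOp (TGIndex.Mn d hL i.1) (L ^ i.1.m * L ^ i.1.k) (TwoGrid.sLap (TGIndex.Mn d hL i.1) (L ^ i.1.m * L ^ i.1.k) ((L ^ i.1.m * L ^ i.1.k : ℕ) : ℝ)) ∘ₗ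
        gOp (TGIndex.Mn d hL i.1) (L ^ i.1.m * L ^ i.1.k) b)
      (BackgroundLayer.fgD d (TGIndex.Mn d hL i.1) (L ^ i.1.m * L ^ i.1.k) b) 0 (fgInstanceC2 d hL i).Bf.one lam) x' := by
    rw [← h0]
    rfl
  rw [h01]
  exact h00

/-- The witness index of the three literals: `(m_T, k, m) = (1, 1, 1)`, direction `0` (`m_T ≥ 1`). [folklore] -/
theorem exists_fgIndexL_m_one (hd : 1 ≤ d) : ∃ i : FGIndexL d, 1 ≤ i.1.1.m := ⟨⟨(⟨1, 1, le_rfl, 1⟩, ⟨0, by omega⟩), le_rfl⟩, le_rfl⟩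

/-- ★★ **THE PRIMITIVE-CARRIER LITERAL `c2Objects` (part 81) HAS A NON-VANISHING OPERATOR KERNEL ENTRY** (`b > 0`, `d ≥ 1`, odd `L > 1`). [bookkeeping] -/
theorem exists_c2Objects_kop_e_ne_zero (hd : 1 ≤ d) (hL : Odd L ∧ 1 < L) {b : ℝ} (hb : 0 < b) (aS : ℝ) (α β : Fin (d + 1)) (c35 p : ℝ) :
    ∃ i n U lam y, (((c2Objects d hL b aS α β c35 p).Kop i).e n U lam y) ≠ 0 := by
  obtain ⟨i, hi⟩ := exists_fgIndexL_m_one hd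
  obtain ⟨lam, y, hne⟩ := exists_fgFamilyC2_e_ne_zero hd hL hb i.1 hi
  exact ⟨i, 0, _, lam, y, hne⟩

/-- ★★ **THE LITERAL WITH THE U-SEEING UNIT LAYER `c2BgObjects` (U-D) HAS A NON-VANISHING OPERATOR KERNEL ENTRY.** [bookkeeping] -/
theorem exists_c2BgObjects_kop_e_ne_zero (hd : 1 ≤ d) (hL : Odd L ∧ 1 < L) {b : ℝ} (hb : 0 < b) (aS : ℝ) (α β : Fin (d + 1)) (c35 p : ℝ) :
    ∃ i n U lam y, (((c2BgObjects d hL b aS α β c35 p).Kop i).e n U lam y) ≠ 0 := by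
  obtain ⟨i, hi⟩ := exists_fgIndexL_m_one hd
  obtain ⟨lam, y, hne⟩ := exists_fgFamilyC2_e_ne_zero hd hL hb i.1 hi
  exact ⟨i, 0, _, lam, y, hne⟩

/-- ★★ **THE LITERAL WITH THE EXACTLY DRESSED UNIT LAYER `c2BgExObjects` (V-D) HAS A NON-VANISHING OPERATOR KERNEL ENTRY.** [bookkeeping] -/
theorem exists_c2BgExObjects_kop_e_ne_zero (hd : 1 ≤ d) (hL : Odd L ∧ 1 < L) {b : ℝ} (hb : 0 < b) (aS : ℝ) (α β : Fin (d + 1)) (c35 p : ℝ) :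
    ∃ i n U lam y, (((c2BgExObjects d hL b aS α β c35 p).Kop i).e n U lam y) ≠ 0 := by
  obtain ⟨i, hi⟩ := exists_fgIndexL_m_one hd
  obtain ⟨lam, y, hne⟩ := exists_fgFamilyC2_e_ne_zero hd hL hb i.1 hi
  exact ⟨i, 0, _, lam, y, hne⟩

/-- The zero-kernel exclusion for `c2Objects`, object level. [bookkeeping] -/
theorem ne_c2Objects_of_kop_zero (hd : 1 ≤ d) (hL : Odd L ∧ 1 < L) {b : ℝ} (hb : 0 < b) (aS : ℝ) (α β : Fin (d + 1)) (c35 p : ℝ) (o : NE2Objects₁₁)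
    (hz : ∀ i n U lam y, (o.Kop i).e n U lam y = 0) : o ≠ c2Objects d hL b aS α β c35 p :=
  ne_of_kop_zero_of_exists_ne o _ hz (exists_c2Objects_kop_e_ne_zero hd hL hb aS α β c35 p)

/-- The zero-kernel exclusion for `c2BgObjects`, object level. [bookkeeping] -/
theorem ne_c2BgObjects_of_kop_zero (hd : 1 ≤ d) (hL : Odd L ∧ 1 < L) {b : ℝ} (hb : 0 < b) (aS : ℝ) (α β : Fin (d + 1)) (c35 p : ℝ) (o : NE2Objects₁₁)
    (hz : ∀ i n U lam y, (o.Kop i).e n U lam y = 0) : o ≠ c2BgObjects d hL b aS α β c35 p :=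
  ne_of_kop_zero_of_exists_ne o _ hz (exists_c2BgObjects_kop_e_ne_zero hd hL hb aS α β c35 p)

/-- The zero-kernel exclusion for `c2BgExObjects`, object level. [bookkeeping] -/
theorem ne_c2BgExObjects_of_kop_zero (hd : 1 ≤ d) (hL : Odd L ∧ 1 < L) {b : ℝ} (hb : 0 < b) (aS : ℝ) (α β : Fin (d + 1)) (c35 p : ℝ) (o : NE2Objects₁₁)
    (hz : ∀ i n U lam y, (o.Kop i).e n U lam y = 0) : o ≠ c2BgExObjects d hL b aS α β c35 p :=
  ne_of_kop_zero_of_exists_ne o _ hz (exists_c2BgExObjects_kop_e_ne_zero hd hL hb aS α β c35 p)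

end Primitive

/-! ## §3 On a datum family's block factor (`d + 1 = 4`): the reading equations of (M) ∕ U-E ∕ V-E fail for zero-kernel values -/

section Family

/-- For a datum family `F` and any `NE2Objects₁₁` value `o` with all operator kernels zero (e.g. the values of dag-n15-w2's p588191 reading): the three reading equations
`o = c2Objects ∕ c2BgObjects ∕ c2BgExObjects 3 F.hL b a_S α α' c₃₅ p` are all FALSE (`b > 0`). [bookkeeping] -/
theorem ne_c2Families_of_kop_zero_family (F : T4Family) {b : ℝ} (hb : 0 < b) (aS : ℝ) (α β : Fin 4) (c35 p : ℝ) (o : NE2Objects₁₁)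
    (hz : ∀ i n U lam y, (o.Kop i).e n U lam y = 0) :
    o ≠ (haveI := neZero_blockFactor F; c2Objects 3 F.hL b aS α β c35 p) ∧ o ≠ (haveI := neZero_blockFactor F; c2BgObjects 3 F.hL b aS α β c35 p) ∧
      o ≠ (haveI := neZero_blockFactor F; c2BgExObjects 3 F.hL b aS α β c35 p) := by
  haveI := neZero_blockFactor F
  exact ⟨ne_c2Objects_of_kop_zero (by norm_num) F.hL hb aS α β c35 p o hz, ne_c2BgObjects_of_kop_zero (by norm_num) F.hL hb aS α β c35 p o hz,
    ne_c2BgExObjects_of_kop_zero (by norm_num) F.hL hb aS α β c35 p o hz⟩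

end Family

end Summit.QuantumFields.YangMills.BalabanUVNodes.N15.SizedNonVanishing
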